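import Summits.BirchSwinnertonDyer.Rank1Residual.X5.TwoAdicInstancesMultAnchorsA
import HarnessLib

/-!
# X5 at `p = 2` (cell `bsd-2adic`, seat `bsd-2adic-mult`, GEN 3): the NON-SPLIT ANCHOR references of door
# (34-GV-mult), part B — 206a1, 1454a1 (and `14a1`, in `TwoAdicInstances158774g.lean`)

HONEST FRAMING (cell `bsd-2adic`, run/shared/lean/pub/bsd-2adic/, D-0036 / D-0054; memo
`HOME/mult/PROOF-GVMULT.md` + ADDENDUM-1): every anchor `A` here is a Cremona curve with `2 ‖ N_A`,
NON-SPLIT multiplicative at `2`, squarefree conductor with `LAW(N_A) = 0`, negative discriminant and ONE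
rational point of order `2` (integral abscissa, Greenberg type B — a Prop-5.14 point); its cyclotomic
invariants `(torsion, μ = 0, λ = 0)` come from GEN-2's `anchor_invariants_of_prop514_nonsplit` given
the displayed K11a at `A`, `hper₀` and the certificates `λ_an(A) = 0`, `μ_an(A) = 0` (STEP-0 GVM kit
j244761: `(μ, λ)_an = (0, 0)` at 30a, 46a, 78a, 142c, 174d, 206a, 1454a). This file only DECIDES
THE CURVE DATA (minimality, ellipticity, multiplicative non-split reduction at `2`, conductor, the unique
type-B `2`-torsion point, `2 ∣ #Ẽ(𝔽_ℓ)` at good odd `ℓ`) for use by the per-class target files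
`TwoAdicInstancesGVM<class>.lean`. Nothing asserted beyond kernel-decided arithmetic; nothing booked.
References: [SilvermanAEC2009] VII.1.1, VII.5.1, VII.3.1; [Silverman1994] IV.10.2; [CremonaAlgorithms1997] Table 1.
-/

set_option autoImplicit false

open IsDedekindDomain WeierstrassCurve Literature.NumberTheory.EllipticCurves
  Literature.NumberTheory.EllipticCurves.ModularForms
  Literature.NumberTheory.EllipticCurves.Rank1Residual
  Literature.NumberTheory.EllipticCurves.Rank1Residual.Typed
  Literature.NumberTheory.EllipticCurves.Greenberg1999
  Literature.NumberTheory.EllipticCurves.PolyCert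
  Literature.NumberTheory.EllipticCurves.Rank1Residual.X11RankOneCertificates
  Summit.BirchSwinnertonDyer.Rank1Residual.X1.MuPart
  Summit.BirchSwinnertonDyer.Rank1Residual.X1.ParitySqueeze
  Summit.BirchSwinnertonDyer.Rank1Residual.X5.O1

open CongruenceSubgroup
open scoped MatrixGroups ModularForm

namespace Summit.BirchSwinnertonDyer.Rank1Residual.X5.Instances

/-- Cremona `206a1` = `[1, 1, 0, 2, 0]` (integer model). [cite: CremonaAlgorithms1997, Table 1] -/
abbrev M206a1 : WeierstrassCurve ℤ := ⟨1, 1, 0, 2, 0⟩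
/-- `206a1 / ℚ`. [cite: CremonaAlgorithms1997, Table 1] -/
abbrev c206a1 : WeierstrassCurve ℚ := M206a1.baseChange ℚ
/-- `Δ(206a1)` (factorisation `{2: 2, 103: 1}`, negative). [cite: CremonaAlgorithms1997, Table 1] -/
theorem M206a1_Δ : M206a1.Δ = -412 := by decide
/-- `c₄(206a1)` (coprime to `Δ`: semistable model). [cite: CremonaAlgorithms1997, Table 1] -/
theorem M206a1_c₄ : M206a1.c₄ = -71 := by decide
/-- `206a1` is an elliptic curve. [cite: CremonaAlgorithms1997, Table 1] -/
instance c206a1_isElliptic : c206a1.IsElliptic := by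
  rw [WeierstrassCurve.isElliptic_iff, baseChange_int_Δ, M206a1_Δ]; norm_num
/-- Cremona's model `206a1` is globally minimal (`gcd(Δ, c₄) = 1`). [cite: SilvermanAEC2009, VII.1 Remark 1.1] -/
instance c206a1_isGloballyMinimal : c206a1.IsGloballyMinimal :=
  isGloballyMinimal_baseChange_int_of_gcd_eq_one 1 1 0 2 0 (by decide)
/-- `Δ(206a1)`, `c₄(206a1)` coprime. [cite: SilvermanAEC2009, VII.5 Prop. 5.1(b)] -/
theorem M206a1_coprime : IsCoprime M206a1.Δ M206a1.c₄ := by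
  rw [M206a1_Δ, M206a1_c₄, Int.isCoprime_iff_gcd_eq_one]; decide
/-- **`206a1` is multiplicative at `2`** (`2 ∣ Δ`, `2 ∤ c₄`). [cite: SilvermanAEC2009, VII.5 Prop. 5.1(b)] -/
theorem mult_two_206a1 : Mult c206a1 2 := by
  have hgen : Rat.HeightOneSpectrum.natGenerator
      ((Rat.HeightOneSpectrum.primesEquiv (R := ℤ)).symm ⟨2, Nat.prime_two⟩) = 2 :=
    Literature.NumberTheory.EllipticCurves.Rat.natGenerator_primesEquiv_symm ⟨2, Nat.prime_two⟩
  have hm := hasMultiplicativeReductionAt_baseChange_int_of_isCoprime M206a1 M206a1_coprime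
    (v := (Rat.HeightOneSpectrum.primesEquiv (R := ℤ)).symm ⟨2, Nat.prime_two⟩)
    (by rw [hgen, M206a1_Δ]; decide)
  exact (hasMultiplicativeReductionAtPrime_iff_hasMultiplicativeReductionAt_holds c206a1
    ⟨2, Nat.prime_two⟩).mpr hm
/-- `206a1 mod 2`. [folklore] -/
theorem M206a1_mod_two : M206a1.map (Int.castRingHom (ZMod 2)) = ⟨1, 1, 0, 0, 0⟩ := by
  ext <;> decide
/-- **`206a1` is NON-SPLIT multiplicative at `2`** (node quadratic `X² + X + 1` has no root in `𝔽₂`).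
[cite: SilvermanAEC2009, VII.5 Prop. 5.1(b)] -/
theorem not_split_two_206a1 : ¬ c206a1.HasSplitMultiplicativeReductionAtPrime 2 := by
  have hint : integralModelInt c206a1 = M206a1 := integralModelInt_baseChange_int M206a1
  have hΔ : ((2 : ℕ) : ℤ) ∣ (integralModelInt c206a1).Δ := by rw [hint, M206a1_Δ]; decide
  have hc₄ : ¬ ((2 : ℕ) : ℤ) ∣ (integralModelInt c206a1).c₄ := by rw [hint, M206a1_c₄]; decide
  rw [LocalTorsionMult.hasSplitMultiplicativeReductionAtPrime_iff_splits_integralModelInt c206a1 2 hΔ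
    hc₄, hint, M206a1_mod_two]
  dsimp only
  rw [sub_eq_add_neg, ← Polynomial.C_neg]
  exact not_splits_quadratic_F2 (by decide) (by decide) (by decide)
/-- **The conductor of `206a1` is `206`** (semistable; Silverman ATAEC IV.10.2). [cite: CremonaAlgorithms1997, Table 1] -/
theorem conductorNorm_206a1 : c206a1.conductorNorm ℤ = 206 := by
  refine conductorNorm_baseChange_int_of_isCoprime M206a1 M206a1_coprime (k := 2) ?_ ?_ ?_
  · rw [Nat.squarefree_iff_nodup_primeFactorsList (by norm_num)]; simp
  · rw [M206a1_Δ]; decide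
  · rw [M206a1_Δ]; decide
/-- The coefficients of `206a1 / ℚ` (unfolded). [cite: CremonaAlgorithms1997, Table 1] -/
theorem c206a1_eq : c206a1 = ⟨1, 1, 0, 2, 0⟩ := by
  rw [c206a1, baseChange_int_eq]; norm_num
/-- `b₂, b₄, b₆` of `206a1`; `2`-division cubic `= (x − (0))(4x² + (5)x + (8))`. [cite: SilvermanAEC2009, III.1] -/
theorem c206a1_b : c206a1.b₂ = 5 ∧ c206a1.b₄ = 4 ∧ c206a1.b₆ = 0 := by
  rw [c206a1_eq]
  simp only [WeierstrassCurve.b₂, WeierstrassCurve.b₄, WeierstrassCurve.b₆]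
  norm_num
/-- The rational point `(0, 0)` of order `2` on `206a1`. [cite: CremonaAlgorithms1997, Table 1] -/
theorem c206a1_P : c206a1.toAffine.Equation 0 0 ∧
    2 * (0 : ℚ) + c206a1.a₁ * 0 + c206a1.a₃ = 0 := by
  rw [c206a1_eq, WeierstrassCurve.Affine.equation_iff]; norm_num
/-- **`(0, 0)` is the ONLY rational point of order `2` on `206a1`** (cofactor of negative discriminant).
[cite: SilvermanAEC2009, III.2.3] -/
theorem c206a1_unique : HasUniqueRationalTwoTorsionX c206a1 0 := by
  refine ⟨⟨0, c206a1_P⟩, fun z hz ↦ ?_⟩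
  have hc := cubic_eq_zero_of_hasRationalTwoTorsionX hz
  obtain ⟨hb₂, hb₄, hb₆⟩ := c206a1_b
  rw [hb₂, hb₄, hb₆] at hc
  have hfac : (z - 0) * (4 * z ^ 2 + 5 * z + 8) = 0 := by linear_combination hc
  rcases mul_eq_zero.mp hfac with h | h
  · linarith
  · nlinarith [sq_nonneg (8 * z + 5)]
/-- **`(0, 0)` is "odd"**: the only real root of the `2`-division cubic. [cite: GreenbergLNM1716, §5 Remark (chunk p0174)] -/
theorem c206a1_odd : TwoTorsionOdd c206a1 0 := by
  intro r hr
  obtain ⟨hb₂, hb₄, hb₆⟩ := c206a1_b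
  rw [hb₂, hb₄, hb₆] at hr
  push_cast at hr
  have hfac : (r - 0) * (4 * r ^ 2 + 5 * r + 8) = 0 := by linear_combination hr
  rcases mul_eq_zero.mp hfac with h | h
  · push_cast; linarith
  · nlinarith [sq_nonneg (8 * r + 5)]
/-- `2 ∣ #Ẽ(𝔽_ℓ)` for `206a1` at every good odd prime `ℓ` (a rational `2`-torsion point). [cite: SilvermanAEC2009, VII.3.1(b)] -/
theorem two_dvd_reductionPointCount_206a1 {ℓ : ℕ} [Fact ℓ.Prime] (hℓ : 3 ≤ ℓ)
    (hΔ : ¬ (ℓ : ℤ) ∣ (-412 : ℤ)) : 2 ∣ c206a1.reductionPointCount ℓ :=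
  two_dvd_reductionPointCount_of_hasRationalTwoTorsionX ⟨0, c206a1_P⟩ hℓ
    (by rw [minimalDiscriminantInt_baseChange_int, M206a1_Δ]; exact hΔ)

/-- Cremona `1454a1` = `[1, 0, 1, -156, 986]` (integer model). [cite: CremonaAlgorithms1997, Table 1] -/
abbrev M1454a1 : WeierstrassCurve ℤ := ⟨1, 0, 1, -156, 986⟩
/-- `1454a1 / ℚ`. [cite: CremonaAlgorithms1997, Table 1] -/
abbrev c1454a1 : WeierstrassCurve ℚ := M1454a1.baseChange ℚ
/-- `Δ(1454a1)` (factorisation `{2: 18, 727: 1}`, negative). [cite: CremonaAlgorithms1997, Table 1] -/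
theorem M1454a1_Δ : M1454a1.Δ = -190578688 := by decide
/-- `c₄(1454a1)` (coprime to `Δ`: semistable model). [cite: CremonaAlgorithms1997, Table 1] -/
theorem M1454a1_c₄ : M1454a1.c₄ = 7465 := by decide
/-- `1454a1` is an elliptic curve. [cite: CremonaAlgorithms1997, Table 1] -/
instance c1454a1_isElliptic : c1454a1.IsElliptic := by
  rw [WeierstrassCurve.isElliptic_iff, baseChange_int_Δ, M1454a1_Δ]; norm_num
/-- Cremona's model `1454a1` is globally minimal (`gcd(Δ, c₄) = 1`). [cite: SilvermanAEC2009, VII.1 Remark 1.1] -/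
instance c1454a1_isGloballyMinimal : c1454a1.IsGloballyMinimal :=
  isGloballyMinimal_baseChange_int_of_gcd_eq_one 1 0 1 (-156) 986 (by decide)
/-- `Δ(1454a1)`, `c₄(1454a1)` coprime. [cite: SilvermanAEC2009, VII.5 Prop. 5.1(b)] -/
theorem M1454a1_coprime : IsCoprime M1454a1.Δ M1454a1.c₄ := by
  rw [M1454a1_Δ, M1454a1_c₄, Int.isCoprime_iff_gcd_eq_one]; decide
/-- **`1454a1` is multiplicative at `2`** (`2 ∣ Δ`, `2 ∤ c₄`). [cite: SilvermanAEC2009, VII.5 Prop. 5.1(b)] -/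
theorem mult_two_1454a1 : Mult c1454a1 2 := by
  have hgen : Rat.HeightOneSpectrum.natGenerator
      ((Rat.HeightOneSpectrum.primesEquiv (R := ℤ)).symm ⟨2, Nat.prime_two⟩) = 2 :=
    Literature.NumberTheory.EllipticCurves.Rat.natGenerator_primesEquiv_symm ⟨2, Nat.prime_two⟩
  have hm := hasMultiplicativeReductionAt_baseChange_int_of_isCoprime M1454a1 M1454a1_coprime
    (v := (Rat.HeightOneSpectrum.primesEquiv (R := ℤ)).symm ⟨2, Nat.prime_two⟩)
    (by rw [hgen, M1454a1_Δ]; decide)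
  exact (hasMultiplicativeReductionAtPrime_iff_hasMultiplicativeReductionAt_holds c1454a1
    ⟨2, Nat.prime_two⟩).mpr hm
/-- `1454a1 mod 2`. [folklore] -/
theorem M1454a1_mod_two : M1454a1.map (Int.castRingHom (ZMod 2)) = ⟨1, 0, 1, 0, 0⟩ := by
  ext <;> decide
/-- **`1454a1` is NON-SPLIT multiplicative at `2`** (node quadratic `X² + X + 1` has no root in `𝔽₂`).
[cite: SilvermanAEC2009, VII.5 Prop. 5.1(b)] -/
theorem not_split_two_1454a1 : ¬ c1454a1.HasSplitMultiplicativeReductionAtPrime 2 := by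
  have hint : integralModelInt c1454a1 = M1454a1 := integralModelInt_baseChange_int M1454a1
  have hΔ : ((2 : ℕ) : ℤ) ∣ (integralModelInt c1454a1).Δ := by rw [hint, M1454a1_Δ]; decide
  have hc₄ : ¬ ((2 : ℕ) : ℤ) ∣ (integralModelInt c1454a1).c₄ := by rw [hint, M1454a1_c₄]; decide
  rw [LocalTorsionMult.hasSplitMultiplicativeReductionAtPrime_iff_splits_integralModelInt c1454a1 2 hΔ
    hc₄, hint, M1454a1_mod_two]
  dsimp only
  rw [sub_eq_add_neg, ← Polynomial.C_neg]
  exact not_splits_quadratic_F2 (by decide) (by decide) (by decide)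
/-- **The conductor of `1454a1` is `1454`** (semistable; Silverman ATAEC IV.10.2). [cite: CremonaAlgorithms1997, Table 1] -/
theorem conductorNorm_1454a1 : c1454a1.conductorNorm ℤ = 1454 := by
  refine conductorNorm_baseChange_int_of_isCoprime M1454a1 M1454a1_coprime (k := 18) ?_ ?_ ?_
  · rw [Nat.squarefree_iff_nodup_primeFactorsList (by norm_num)]; simp
  · rw [M1454a1_Δ]; decide
  · rw [M1454a1_Δ]; decide
/-- The coefficients of `1454a1 / ℚ` (unfolded). [cite: CremonaAlgorithms1997, Table 1] -/
theorem c1454a1_eq : c1454a1 = ⟨1, 0, 1, -156, 986⟩ := by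
  rw [c1454a1, baseChange_int_eq]; norm_num
/-- `b₂, b₄, b₆` of `1454a1`; `2`-division cubic `= (x − (-15))(4x² + (-59)x + (263))`. [cite: SilvermanAEC2009, III.1] -/
theorem c1454a1_b : c1454a1.b₂ = 1 ∧ c1454a1.b₄ = -311 ∧ c1454a1.b₆ = 3945 := by
  rw [c1454a1_eq]
  simp only [WeierstrassCurve.b₂, WeierstrassCurve.b₄, WeierstrassCurve.b₆]
  norm_num
/-- The rational point `(-15, 7)` of order `2` on `1454a1`. [cite: CremonaAlgorithms1997, Table 1] -/
theorem c1454a1_P : c1454a1.toAffine.Equation (-15) 7 ∧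
    2 * (7 : ℚ) + c1454a1.a₁ * (-15) + c1454a1.a₃ = 0 := by
  rw [c1454a1_eq, WeierstrassCurve.Affine.equation_iff]; norm_num
/-- **`(-15, 7)` is the ONLY rational point of order `2` on `1454a1`** (cofactor of negative discriminant).
[cite: SilvermanAEC2009, III.2.3] -/
theorem c1454a1_unique : HasUniqueRationalTwoTorsionX c1454a1 (-15) := by
  refine ⟨⟨7, c1454a1_P⟩, fun z hz ↦ ?_⟩
  have hc := cubic_eq_zero_of_hasRationalTwoTorsionX hz
  obtain ⟨hb₂, hb₄, hb₆⟩ := c1454a1_b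
  rw [hb₂, hb₄, hb₆] at hc
  have hfac : (z - (-15)) * (4 * z ^ 2 + (-59) * z + 263) = 0 := by linear_combination hc
  rcases mul_eq_zero.mp hfac with h | h
  · linarith
  · nlinarith [sq_nonneg (8 * z + (-59))]
/-- **`(-15, 7)` is "odd"**: the only real root of the `2`-division cubic. [cite: GreenbergLNM1716, §5 Remark (chunk p0174)] -/
theorem c1454a1_odd : TwoTorsionOdd c1454a1 (-15) := by
  intro r hr
  obtain ⟨hb₂, hb₄, hb₆⟩ := c1454a1_b
  rw [hb₂, hb₄, hb₆] at hr
  push_cast at hr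
  have hfac : (r - (-15)) * (4 * r ^ 2 + (-59) * r + 263) = 0 := by linear_combination hr
  rcases mul_eq_zero.mp hfac with h | h
  · push_cast; linarith
  · nlinarith [sq_nonneg (8 * r + (-59))]
/-- `2 ∣ #Ẽ(𝔽_ℓ)` for `1454a1` at every good odd prime `ℓ` (a rational `2`-torsion point). [cite: SilvermanAEC2009, VII.3.1(b)] -/
theorem two_dvd_reductionPointCount_1454a1 {ℓ : ℕ} [Fact ℓ.Prime] (hℓ : 3 ≤ ℓ)
    (hΔ : ¬ (ℓ : ℤ) ∣ (-190578688 : ℤ)) : 2 ∣ c1454a1.reductionPointCount ℓ :=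
  two_dvd_reductionPointCount_of_hasRationalTwoTorsionX ⟨7, c1454a1_P⟩ hℓ
    (by rw [minimalDiscriminantInt_baseChange_int, M1454a1_Δ]; exact hΔ)

end Summit.BirchSwinnertonDyer.Rank1Residual.X5.Instances
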